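import Mathlib.Analysis.ODE.Gronwall
import Mathlib.MeasureTheory.Integral.IntervalIntegral.FundThmCalculus
import Mathlib.MeasureTheory.Integral.DominatedConvergence
import Mathlib.Analysis.SpecialFunctions.ExpDeriv
import Literature.Analysis.FunctionSpaces.TorusCalculus
import Literature.Analysis.FluidPDE.LagrangianLatticeCarrier
import HarnessLib

/-!
# Distortion of a flow from its integral equation: a `K`-Lipschitz field displaces `(e^{KΔt} − 1)`-Lipschitzly

Helper file for the Lagrangian cone of route `SolenoidalFractalHomogenisation` (K1L `LagrangianRenormalisationStep`, stmt-AnomalousDissipation-24912: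
distortion hypothesis `strain m ≤ θ (m+1)` of `stub_oneLevelL` / tail step `stub_tailL`; K3L stmt-AnomalousDissipation-24913: clause (F1c) of
`LevelRegular`).  Armstrong–Vicol §5.1 (arXiv:2305.05048): on a refresh window the Lagrangian flow `X` of the coarse field `b_{≤m}` stays close to the
identity in `C¹`, `‖∇X − I‖ ≲ Lip(b_{≤m}) · (window length) = strain`.  In the tree the flow is given by its INTEGRAL EQUATION
(`LagrangianLatticeCarrier.IsFlow`: `disp m t s x = ∫_s^t b_{≤m}(r, X m r s x) dr`, `X = x + proj ∘ disp`); lifted to `ℝ³` this is the abstract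
situation of this file: a displacement `φ : ℝ → E → E` with `φ t y = ∫_a^t V r (y + φ r y) dr` on `[a, b]` for a field `V` that is jointly continuous
and `K`-Lipschitz in space.  Conclusion (`norm_displacement_sub_le`): `‖φ t y₁ − φ t y₂‖ ≤ (exp (K (t − a)) − 1) ‖y₁ − y₂‖` — Grönwall for the two
trajectories (`dist_le_of_trajectories_ODE_of_mem`, Mathlib) followed by one more integration of the Lipschitz bound; hence the distortion of the
flow map `y ↦ y + φ t y` is at most `e^{K(t−a)} − 1` in Lipschitz (and, where differentiable, operator) norm (`lipschitzWith_displacement`,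
`norm_fderiv_displacement_le`).  Pure real analysis on a complete normed space; no definitions, no named facts, no sorry.
Prover seat `ad-solenoidal-k2r-lowerlaw-p1` g5, 2026-08-28.
-/

set_option linter.dupNamespace false

noncomputable section

namespace Summit.AnomalousDissipation.AnomalousDissipation.Theorems.SolenoidalFractalHomogenisation.LagrangianCarrier

open Set Filter Topology MeasureTheory intervalIntegral
open scoped NNReal

variable {E : Type*} [NormedAddCommGroup E] [NormedSpace ℝ E] [CompleteSpace E]

/-- `∫_a^t K e^{K(r−a)} dr = e^{K(t−a)} − 1`. [folklore] -/
theorem integral_mul_exp_mul_sub (K a t : ℝ) :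
    ∫ r in a..t, K * Real.exp (K * (r - a)) = Real.exp (K * (t - a)) - 1 := by
  have hderiv : ∀ r, HasDerivAt (fun r => Real.exp (K * (r - a))) (K * Real.exp (K * (r - a))) r := by
    intro r
    have h := ((hasDerivAt_id r).sub_const a).const_mul K |>.exp
    simpa [mul_comm] using h
  rw [integral_eq_sub_of_hasDerivAt (fun r _ => hderiv r)
    ((continuous_const.mul (Real.continuous_exp.comp (continuous_const.mul (continuous_id.sub continuous_const)))).intervalIntegrable _ _)]
  simp

/-- **Grönwall distortion bound for a displacement solving the integral flow equation.**  Let `V : ℝ → E → E` be jointly continuous and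
`K`-Lipschitz in space on `[a, b]`, and let `φ : ℝ → E → E` be continuous in time on `[a, b]` with
`φ t y = ∫_a^t V r (y + φ r y) dr` for `t ∈ [a, b]`.  Then for `t ∈ [a, b]`,
`‖φ t y₁ − φ t y₂‖ ≤ (exp (K (t − a)) − 1) · ‖y₁ − y₂‖`.
[cite: ArmstrongVicol2025, §5.1 (flow estimates on the refresh windows: ∇X stays close to the identity)] -/
theorem norm_displacement_sub_le {V : ℝ → E → E} {K : ℝ≥0} {a b : ℝ}
    (hV : ∀ t ∈ Icc a b, LipschitzWith K (V t)) (hVc : Continuous fun p : ℝ × E => V p.1 p.2)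
    {φ : ℝ → E → E} (hφc : ∀ y, ContinuousOn (fun t => φ t y) (Icc a b))
    (hφ : ∀ y, ∀ t ∈ Icc a b, φ t y = ∫ r in a..t, V r (y + φ r y)) :
    ∀ t ∈ Icc a b, ∀ y₁ y₂ : E, ‖φ t y₁ - φ t y₂‖ ≤ (Real.exp (K * (t - a)) - 1) * ‖y₁ - y₂‖ := by
  intro t ht y₁ y₂
  -- the integrands `g_i r = V r (y_i + φ r y_i)` are continuous on `[a, b]`
  set g : E → ℝ → E := fun y r => V r (y + φ r y) with hg
  have hgc : ∀ y, ContinuousOn (g y) (Icc a b) := fun y =>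
    hVc.comp_continuousOn (continuousOn_id.prodMk (continuousOn_const.add (hφc y)))
  have hgi : ∀ y, ∀ s ∈ Icc a b, IntervalIntegrable (g y) volume a s := fun y s hs =>
    ((hgc y).mono (uIcc_subset_Icc ⟨le_rfl, ht.1.trans ht.2⟩ ⟨hs.1, hs.2⟩ |>.trans' (by
      rw [uIcc_of_le hs.1]))).intervalIntegrable
  -- the trajectories `f_i s = y_i + ∫_a^s g_i`
  set f : E → ℝ → E := fun y s => y + ∫ r in a..s, g y r with hf
  have hf_eq : ∀ y, ∀ s ∈ Icc a b, f y s = y + φ s y := fun y s hs => by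
    show y + ∫ r in a..s, g y r = y + φ s y
    rw [hφ y s hs]
  have hfc : ∀ y, ContinuousOn (f y) (Icc a b) := fun y => by
    have h := continuousOn_primitive_interval (μ := volume) (a := a) (b := b) (f := g y)
      (((hgc y).mono (by rw [uIcc_of_le (ht.1.trans ht.2)])).integrableOn_compact isCompact_uIcc)
    rw [uIcc_of_le (ht.1.trans ht.2)] at h
    exact continuousOn_const.add h
  have hf' : ∀ y, ∀ s ∈ Ico a b, HasDerivWithinAt (f y) (V s (f y s)) (Ici s) s := by
    intro y s hs
    have hsI : s ∈ Icc a b := Ico_subset_Icc_self hs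
    haveI : Fact (s ∈ Icc a b) := ⟨hsI⟩
    have hmeas : StronglyMeasurableAtFilter (g y) (𝓝[Icc a b] s) volume :=
      (hgc y).stronglyMeasurableAtFilter_nhdsWithin measurableSet_Icc s
    have hD : HasDerivWithinAt (fun u => ∫ r in a..u, g y r) (g y s) (Icc a b) s :=
      integral_hasDerivWithinAt_right (hgi y s hsI) hmeas ((hgc y).continuousWithinAt hsI)
    have hD' : HasDerivWithinAt (f y) (g y s) (Icc a b) s := hD.const_add y
    have hval : g y s = V s (f y s) := by rw [hf_eq y s hsI]
    rw [← hval]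
    exact hD'.mono_of_mem_nhdsWithin (Icc_mem_nhdsGE_of_mem hs)
  -- Grönwall for the two trajectories
  have hgron := dist_le_of_trajectories_ODE_of_mem (v := V) (s := fun _ => (univ : Set E)) (K := K)
    (fun s hs => (hV s (Ico_subset_Icc_self hs)).lipschitzOnWith) (hfc y₁) (hf' y₁) (fun _ _ => trivial)
    (hfc y₂) (hf' y₂) (fun _ _ => trivial) (δ := dist y₁ y₂) (by simp [hf])
  -- integrate the Lipschitz bound once more
  have hbound : ∀ r ∈ Icc a t, ‖g y₁ r - g y₂ r‖ ≤ K * Real.exp (K * (r - a)) * ‖y₁ - y₂‖ := by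
    intro r hr
    have hrI : r ∈ Icc a b := ⟨hr.1, hr.2.trans ht.2⟩
    calc ‖g y₁ r - g y₂ r‖ = dist (V r (f y₁ r)) (V r (f y₂ r)) := by
          rw [dist_eq_norm, hg, hf_eq y₁ r hrI, hf_eq y₂ r hrI]
      _ ≤ K * dist (f y₁ r) (f y₂ r) := (hV r hrI).dist_le_mul _ _
      _ ≤ K * (dist y₁ y₂ * Real.exp (K * (r - a))) :=
          mul_le_mul_of_nonneg_left (hgron r hrI) K.coe_nonneg
      _ = K * Real.exp (K * (r - a)) * ‖y₁ - y₂‖ := by rw [dist_eq_norm]; ring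
  have hdiff : φ t y₁ - φ t y₂ = ∫ r in a..t, (g y₁ r - g y₂ r) := by
    rw [hφ y₁ t ht, hφ y₂ t ht, ← integral_sub (hgi y₁ t ht) (hgi y₂ t ht)]
  rw [hdiff]
  calc ‖∫ r in a..t, (g y₁ r - g y₂ r)‖ ≤ ∫ r in a..t, K * Real.exp (K * (r - a)) * ‖y₁ - y₂‖ := by
        refine norm_integral_le_of_norm_le ht.1 ?_ ?_
        · exact ae_of_all _ fun r hr => hbound r ⟨hr.1.le, hr.2⟩
        · exact (by fun_prop : Continuous fun r => (K : ℝ) * Real.exp (K * (r - a)) * ‖y₁ - y₂‖).intervalIntegrable _ _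
    _ = (Real.exp (K * (t - a)) - 1) * ‖y₁ - y₂‖ := by
        rw [intervalIntegral.integral_mul_const, integral_mul_exp_mul_sub]

/-- The flow map `y ↦ y + φ t y` is `exp(K(t−a))`-Lipschitz and its displacement is `(exp(K(t−a)) − 1)`-Lipschitz. [cite: ArmstrongVicol2025, §5.1] -/
theorem lipschitzWith_displacement {V : ℝ → E → E} {K : ℝ≥0} {a b : ℝ}
    (hV : ∀ t ∈ Icc a b, LipschitzWith K (V t)) (hVc : Continuous fun p : ℝ × E => V p.1 p.2)
    {φ : ℝ → E → E} (hφc : ∀ y, ContinuousOn (fun t => φ t y) (Icc a b))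
    (hφ : ∀ y, ∀ t ∈ Icc a b, φ t y = ∫ r in a..t, V r (y + φ r y)) {t : ℝ} (ht : t ∈ Icc a b) :
    LipschitzWith ⟨Real.exp (K * (t - a)) - 1, by
      have : (1 : ℝ) ≤ Real.exp (K * (t - a)) := Real.one_le_exp (mul_nonneg K.coe_nonneg (by linarith [ht.1]))
      linarith⟩ (φ t) :=
  LipschitzWith.of_dist_le_mul fun y₁ y₂ => by
    rw [dist_eq_norm, dist_eq_norm]
    exact norm_displacement_sub_le hV hVc hφc hφ t ht y₁ y₂

/-- Operator-norm form of the distortion bound: wherever the displacement is differentiated, `‖D(φ t) y‖ ≤ exp(K(t−a)) − 1`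
(norm of a derivative ≤ Lipschitz constant). [cite: ArmstrongVicol2025, §5.1 (∇X close to the identity)] -/
theorem norm_fderiv_displacement_le {V : ℝ → E → E} {K : ℝ≥0} {a b : ℝ}
    (hV : ∀ t ∈ Icc a b, LipschitzWith K (V t)) (hVc : Continuous fun p : ℝ × E => V p.1 p.2)
    {φ : ℝ → E → E} (hφc : ∀ y, ContinuousOn (fun t => φ t y) (Icc a b))
    (hφ : ∀ y, ∀ t ∈ Icc a b, φ t y = ∫ r in a..t, V r (y + φ r y)) {t : ℝ} (ht : t ∈ Icc a b) (y : E) :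
    ‖fderiv ℝ (φ t) y‖ ≤ Real.exp (K * (t - a)) - 1 := by
  have h := norm_fderiv_le_of_lipschitz ℝ (x₀ := y) (lipschitzWith_displacement hV hVc hφc hφ ht)
  exact_mod_cast h

/-! ## The Lagrangian flows of a lattice carrier: distortion from `IsFlow` and a Lipschitz bound on the coarse field -/

section Carrier

open Literature.Analysis Literature.Analysis.FunctionSpaces Literature.Analysis.FunctionSpaces.Torus
open Literature.Analysis.FluidPDE Literature.Analysis.FluidPDE.LatticeShear Function

variable {k : ℕ}

/-- **Distortion of the coarse flow on a window** (Armstrong–Vicol §5.1, `‖∇X_m − I‖ ≲ Lip(b_{≤m})·Δt`): if `disp m` solves the integral flow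
equation (`IsFlow m`), the partial sum `b 1 + ⋯ + b m` is jointly continuous and its lifts are `K`-Lipschitz for `r ∈ [w, T₁]`, and
`t ↦ disp m t w x` is continuous on `[w, T₁]` (clause (F1a) of `LevelRegular`), then for `t ∈ [w, T₁]` the displacement lifts are
`(e^{K(t−w)} − 1)`-Lipschitz: `‖disp m t w (proj y₁) − disp m t w (proj y₂)‖ ≤ (exp (K (t − w)) − 1) ‖y₁ − y₂‖`.
[cite: ArmstrongVicol2025, §5.1 (flow estimates on the refresh windows)] -/
theorem norm_disp_sub_le_of_isFlow (E : LagrangianLatticeCarrier k) (m : ℕ) (hF : E.IsFlow m) {w T₁ : ℝ} {K : ℝ≥0}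
    (hc : Continuous (uncurry (E.partialSum m)))
    (hK : ∀ r ∈ Icc w T₁, LipschitzWith K (lift (E.partialSum m r)))
    (hdc : ∀ x, ContinuousOn (fun t => E.disp m t w x) (Icc w T₁)) {t : ℝ} (ht : t ∈ Icc w T₁)
    (y₁ y₂ : EuclideanSpace ℝ (Fin 3)) :
    ‖E.disp m t w (proj y₁) - E.disp m t w (proj y₂)‖ ≤ (Real.exp (K * (t - w)) - 1) * ‖y₁ - y₂‖ := by
  have hVc : Continuous fun p : ℝ × EuclideanSpace ℝ (Fin 3) => lift (E.partialSum m p.1) p.2 :=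
    hc.comp (continuous_fst.prodMk (continuous_proj.comp continuous_snd))
  have hφ : ∀ y, ∀ t ∈ Icc w T₁, E.disp m t w (proj y) =
      ∫ r in w..t, lift (E.partialSum m r) (y + E.disp m r w (proj y)) := by
    intro y t _
    rw [hF t w (proj y)]
    refine intervalIntegral.integral_congr fun r _ => ?_
    simp only [lift_apply, LagrangianLatticeCarrier.X_apply, proj_add]
  exact norm_displacement_sub_le (V := fun r y => lift (E.partialSum m r) y) (φ := fun t y => E.disp m t w (proj y))
    hK hVc (fun y => hdc (proj y)) hφ t ht y₁ y₂

/-- **Operator form of the window distortion**: `‖flowDeriv m t w x − id‖ ≤ exp (K (t − w)) − 1` (the derivative of the displacement lift is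
bounded by its Lipschitz constant; `flowDeriv = id + D(lift disp)(repr x)`). With `K·(T₁ − w) ≤ strain ≤ θ` this is the distortion budget
of the Lagrangian template. [cite: ArmstrongVicol2025, §5.1 (∇X_{m−1} close to the identity on the refresh windows)] -/
theorem norm_flowDeriv_sub_id_le_of_isFlow (E : LagrangianLatticeCarrier k) (m : ℕ) (hF : E.IsFlow m) {w T₁ : ℝ} {K : ℝ≥0}
    (hc : Continuous (uncurry (E.partialSum m)))
    (hK : ∀ r ∈ Icc w T₁, LipschitzWith K (lift (E.partialSum m r)))
    (hdc : ∀ x, ContinuousOn (fun t => E.disp m t w x) (Icc w T₁)) {t : ℝ} (ht : t ∈ Icc w T₁)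
    (x : UnitAddTorus (Fin 3)) :
    ‖E.flowDeriv m t w x - ContinuousLinearMap.id ℝ (EuclideanSpace ℝ (Fin 3))‖ ≤ Real.exp (K * (t - w)) - 1 := by
  have hlip : LipschitzWith ⟨Real.exp (K * (t - w)) - 1, by
      have : (1 : ℝ) ≤ Real.exp (K * (t - w)) := Real.one_le_exp (mul_nonneg K.coe_nonneg (by linarith [ht.1]))
      linarith⟩ (lift (E.disp m t w)) :=
    LipschitzWith.of_dist_le_mul fun y₁ y₂ => by
      rw [dist_eq_norm, dist_eq_norm, lift_apply, lift_apply]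
      exact norm_disp_sub_le_of_isFlow E m hF hc hK hdc ht y₁ y₂
  rw [LagrangianLatticeCarrier.flowDeriv, add_sub_cancel_left]
  have h := norm_fderiv_le_of_lipschitz ℝ (x₀ := repr x) hlip
  exact_mod_cast h

end Carrier

section Uniqueness

/-- **Uniqueness for the integral flow equation** (appended 2026-08-28): two displacements, continuous in time on `[a, b]`, solving
`φ t y = ∫_a^t V r (y + φ r y) dr` for the same jointly continuous, spatially `K`-Lipschitz field coincide on `[a, b]` — so a flow given
implicitly by `LagrangianLatticeCarrier.IsFlow` can be IDENTIFIED with any explicit candidate (e.g. a composition of slot shears and coarse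
flows) that satisfies the same equation.  Grönwall with zero initial distance (`dist_le_of_trajectories_ODE_of_mem`).
[cite: ArmstrongVicol2025, §2.2 (PDF p. 18: the flows X_m are determined by b_{≤m})] -/
theorem displacement_unique {V : ℝ → E → E} {K : ℝ≥0} {a b : ℝ}
    (hV : ∀ t ∈ Icc a b, LipschitzWith K (V t)) (hVc : Continuous fun p : ℝ × E => V p.1 p.2)
    {φ₁ φ₂ : ℝ → E → E}
    (hφ₁c : ∀ y, ContinuousOn (fun t => φ₁ t y) (Icc a b)) (hφ₁ : ∀ y, ∀ t ∈ Icc a b, φ₁ t y = ∫ r in a..t, V r (y + φ₁ r y))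
    (hφ₂c : ∀ y, ContinuousOn (fun t => φ₂ t y) (Icc a b)) (hφ₂ : ∀ y, ∀ t ∈ Icc a b, φ₂ t y = ∫ r in a..t, V r (y + φ₂ r y)) :
    ∀ t ∈ Icc a b, ∀ y : E, φ₁ t y = φ₂ t y := by
  intro t ht y
  -- trajectories of the two displacements from the same initial point
  have key : ∀ (φ : ℝ → E → E), (ContinuousOn (fun t => φ t y) (Icc a b)) →
      (∀ t ∈ Icc a b, φ t y = ∫ r in a..t, V r (y + φ r y)) →
      ContinuousOn (fun s => y + ∫ r in a..s, V r (y + φ r y)) (Icc a b) ∧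
      (∀ s ∈ Ico a b, HasDerivWithinAt (fun s => y + ∫ r in a..s, V r (y + φ r y))
        (V s ((fun s => y + ∫ r in a..s, V r (y + φ r y)) s)) (Ici s) s) := by
    intro φ hφc hφ
    have hgc : ContinuousOn (fun r => V r (y + φ r y)) (Icc a b) :=
      hVc.comp_continuousOn (continuousOn_id.prodMk (continuousOn_const.add hφc))
    have hgi : ∀ s ∈ Icc a b, IntervalIntegrable (fun r => V r (y + φ r y)) volume a s := fun s hs =>
      (hgc.mono (by rw [uIcc_of_le hs.1]; exact Icc_subset_Icc_right hs.2)).intervalIntegrable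
    refine ⟨?_, ?_⟩
    · have h := continuousOn_primitive_interval (μ := volume) (a := a) (b := b) (f := fun r => V r (y + φ r y))
        ((hgc.mono (by rw [uIcc_of_le (ht.1.trans ht.2)])).integrableOn_compact isCompact_uIcc)
      rw [uIcc_of_le (ht.1.trans ht.2)] at h
      exact continuousOn_const.add h
    · intro s hs
      have hsI : s ∈ Icc a b := Ico_subset_Icc_self hs
      haveI : Fact (s ∈ Icc a b) := ⟨hsI⟩
      have hmeas : StronglyMeasurableAtFilter (fun r => V r (y + φ r y)) (𝓝[Icc a b] s) volume :=
        hgc.stronglyMeasurableAtFilter_nhdsWithin measurableSet_Icc s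
      have hD : HasDerivWithinAt (fun u => ∫ r in a..u, V r (y + φ r y)) (V s (y + φ s y)) (Icc a b) s :=
        integral_hasDerivWithinAt_right (hgi s hsI) hmeas (hgc.continuousWithinAt hsI)
      have hval : V s (y + φ s y) = V s (y + ∫ r in a..s, V r (y + φ r y)) := by rw [← hφ s hsI]
      rw [← hval]
      exact (hD.const_add y).mono_of_mem_nhdsWithin (Icc_mem_nhdsGE_of_mem hs)
  obtain ⟨hc₁, hd₁⟩ := key φ₁ (hφ₁c y) (hφ₁ y)
  obtain ⟨hc₂, hd₂⟩ := key φ₂ (hφ₂c y) (hφ₂ y)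
  have hgron := dist_le_of_trajectories_ODE_of_mem (v := V) (s := fun _ => (univ : Set E)) (K := K)
    (fun s hs => (hV s (Ico_subset_Icc_self hs)).lipschitzOnWith) hc₁ hd₁ (fun _ _ => trivial)
    hc₂ hd₂ (fun _ _ => trivial) (δ := 0) (by simp) t ht
  rw [zero_mul] at hgron
  have heq : (y + ∫ r in a..t, V r (y + φ₁ r y)) = y + ∫ r in a..t, V r (y + φ₂ r y) :=
    dist_le_zero.mp hgron
  rw [hφ₁ y t ht, hφ₂ y t ht]
  exact add_left_cancel heq

end Uniqueness

end Summit.AnomalousDissipation.AnomalousDissipation.Theorems.SolenoidalFractalHomogenisation.LagrangianCarrier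

end
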